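import Mathlib.Analysis.InnerProductSpace.PiL2
import Mathlib.Analysis.Calculus.FDeriv.Add
import Mathlib.Analysis.Calculus.FDeriv.Linear
import Mathlib.Topology.Order.Lattice
import Mathlib.Data.Fin.Tuple.Sort
import Literature.MathematicalPhysics.QuantumFieldTheory.Balaban1983to89.B4Eq19LatticeOperators
import HarnessLib

/-!
# The Courant `P1` interpolant of a lattice map on the Freudenthal–Kuhn triangulation of `ℝ³` — hat letters and the
# affine structure on each Kuhn simplex (K2 organ `hImproveCoreFlat`, ORGAN memo §4 brick B3 «compactness ∕ interpolation
# package», mesh-side half; cell ym3-torus, seat px7 g7, LOCATE `LOCATE-B3a-KUHN-INTERPOLANT-px7g7.md`)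

Helper toward crux `stmt-QuantumFields-19936` (`Summit.QuantumFields.YangMills.Theses.UnitScaleTilt.HistoryTailL`), road R1
(blow-down) of the K2 organ `hImproveCoreFlat` (LEAD ym-ust-19936-w1 g9, frozen text v1 `bac8eda3`): the organ speaks of unit
lattice maps `u : Zd 3 → E` and their flat lattice Dirichlet energy `∑_{y ∈ box z R} ∑_μ ‖u (y + unitVec μ) - u y‖ ^ 2`; the blow-down
compares `u` at mesh `R⁻¹` with a CONTINUUM map.  The comparison map of record is the Courant `P1` interpolant on the
Freudenthal–Kuhn triangulation (every unit cube `y + [0,1]³` cut into the six simplices `1 ≥ t (σ 0) ≥ t (σ 1) ≥ t (σ 2) ≥ 0`,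
`σ ∈ S₃`, `t = x - y`), which has the PERMUTATION-FREE closed form
  `(I u)(x) = ∑_w φ (x - w) • u w`,  `φ t = max 0 (1 + min 0 (min (t 0) (min (t 1) (t 2))) - max 0 (max (t 0) (max (t 1) (t 2))))`
(the Kuhn hat).  This file is DEF-FREE: the hat `φ` and the interpolant `I` are VARIABLES carrying their defining equations as
hypotheses (`hφ`, `hI`), so every consumer instantiates them with `fun _ => rfl`.

WHAT IS PROVED (all `theorem`s, Mathlib + `B4Eq19LatticeOperators` only).  §1 hat letters: `0 ≤ φ ≤ 1`, `φ 0 = 1`, support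
(`φ t = 0` once some `t i ≥ 1` or `t i ≤ -1`), continuity.  §2 on the closed Kuhn simplex of `σ`: the hat at the path vertex
`v_k = e_{σ 0} + ⋯ + e_{σ (k-1)}` is the `k`-th barycentric coordinate (`hat_sub_vertex`), and it VANISHES at every other lattice
point (`hat_sub_int_eq_zero`).  §3 the interpolant on the simplex: the lattice sum collapses to the four path vertices
(`interp_eq_sum_vertices`), Abel form `I x = u y + ∑_k (x (σ k) - y (σ k)) • (u (p_k + unitVec (σ k)) - u p_k)` with
`p_k = y + v_k` — the coefficients ARE the bond differences of the monotone lattice path (`interp_eq_affine`), vertex exactness,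
partition of unity, `‖I x‖ ≤ 1` for unit `u`, and the pointwise distance row `‖I x - u y‖ ≤ ∑_k ‖u (p_k + e_{σ k}) - u p_k‖`.
§4 on the OPEN simplex `I` is differentiable with derivative `L_σ = ∑_k proj (σ k) • δ_k` and energy density
`∑_i ‖L_σ eᵢ‖² = ∑_k ‖δ_k‖²` (`hasFDerivAt_interp`, `sum_normSq_deriv_eq`).  The measure-theoretic half (volume `1∕6` of each
Kuhn simplex, the per-cube energy identity, box sums) is the sibling file `PoincareLipschitzKuhnEnergy`.

HONEST: elementary finite-dimensional algebra; nothing of `hImproveCoreFlat`, K1, `MeanDeviationL`, `HistoryTailL` or any rung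
statement is proved here; YM₃ on T³ is ladder rung R3 — not d = 4, not infinite volume, not a mass gap, not Clay.
-/

open scoped BigOperators
open Literature.MathematicalPhysics.QuantumFieldTheory.Balaban1983to89 B4Eq19LatticeOperators

noncomputable section

namespace Summit.QuantumFields.YangMills.Theorems.PoincareLipschitzKuhnHat

/-! ## §0 Three-term `min` ∕ `max` bookkeeping -/

/-- `min` of three values is invariant under a permutation of the index. -/
theorem min3_perm (f : Fin 3 → ℝ) (σ : Equiv.Perm (Fin 3)) :
    min (f 0) (min (f 1) (f 2)) = min (f (σ 0)) (min (f (σ 1)) (f (σ 2))) := by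
  have hL : ∀ i, min (f 0) (min (f 1) (f 2)) ≤ f i := by
    intro i; fin_cases i
    · exact min_le_left _ _
    · exact min_le_of_right_le (min_le_left _ _)
    · exact min_le_of_right_le (min_le_right _ _)
  have hR : ∀ j, min (f (σ 0)) (min (f (σ 1)) (f (σ 2))) ≤ f (σ j) := by
    intro j; fin_cases j
    · exact min_le_left _ _
    · exact min_le_of_right_le (min_le_left _ _)
    · exact min_le_of_right_le (min_le_right _ _)
  have hR' : ∀ i, min (f (σ 0)) (min (f (σ 1)) (f (σ 2))) ≤ f i := fun i => by
    simpa using hR (σ.symm i)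
  exact le_antisymm (le_min (hL _) (le_min (hL _) (hL _))) (le_min (hR' _) (le_min (hR' _) (hR' _)))

/-- `max` of three values is invariant under a permutation of the index. -/
theorem max3_perm (f : Fin 3 → ℝ) (σ : Equiv.Perm (Fin 3)) :
    max (f 0) (max (f 1) (f 2)) = max (f (σ 0)) (max (f (σ 1)) (f (σ 2))) := by
  have hL : ∀ i, f i ≤ max (f 0) (max (f 1) (f 2)) := by
    intro i; fin_cases i
    · exact le_max_left _ _
    · exact le_max_of_le_right (le_max_left _ _)
    · exact le_max_of_le_right (le_max_right _ _)
  have hR : ∀ j, f (σ j) ≤ max (f (σ 0)) (max (f (σ 1)) (f (σ 2))) := by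
    intro j; fin_cases j
    · exact le_max_left _ _
    · exact le_max_of_le_right (le_max_left _ _)
    · exact le_max_of_le_right (le_max_right _ _)
  have hR' : ∀ i, f i ≤ max (f (σ 0)) (max (f (σ 1)) (f (σ 2))) := fun i => by
    simpa using hR (σ.symm i)
  exact le_antisymm (max_le (hR' _) (max_le (hR' _) (hR' _))) (max_le (hL _) (max_le (hL _) (hL _)))

/-- `min 0 (min₃ f) ≤ f i`. -/
theorem min0_min3_le (f : Fin 3 → ℝ) (i : Fin 3) : min 0 (min (f 0) (min (f 1) (f 2))) ≤ f i := by
  fin_cases i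
  · exact min_le_of_right_le (min_le_left _ _)
  · exact min_le_of_right_le (min_le_of_right_le (min_le_left _ _))
  · exact min_le_of_right_le (min_le_of_right_le (min_le_right _ _))

/-- `f i ≤ max 0 (max₃ f)`. -/
theorem le_max0_max3 (f : Fin 3 → ℝ) (i : Fin 3) : f i ≤ max 0 (max (f 0) (max (f 1) (f 2))) := by
  fin_cases i
  · exact le_max_of_le_right (le_max_left _ _)
  · exact le_max_of_le_right (le_max_of_le_right (le_max_left _ _))
  · exact le_max_of_le_right (le_max_of_le_right (le_max_right _ _))

/-! ## §1 The Kuhn hat: letters -/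

variable {E : Type*} [NormedAddCommGroup E] [NormedSpace ℝ E]
variable (φ : (Fin 3 → ℝ) → ℝ)

/-- The Kuhn hat is non-negative. -/
theorem hat_nonneg
    (hφ : ∀ t, φ t = max 0 (1 + min 0 (min (t 0) (min (t 1) (t 2))) - max 0 (max (t 0) (max (t 1) (t 2)))))
    (t : Fin 3 → ℝ) : 0 ≤ φ t := by
  rw [hφ]; exact le_max_left _ _

/-- The Kuhn hat is at most `1`. -/
theorem hat_le_one
    (hφ : ∀ t, φ t = max 0 (1 + min 0 (min (t 0) (min (t 1) (t 2))) - max 0 (max (t 0) (max (t 1) (t 2)))))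
    (t : Fin 3 → ℝ) : φ t ≤ 1 := by
  rw [hφ]
  refine max_le zero_le_one ?_
  have h1 : min 0 (min (t 0) (min (t 1) (t 2))) ≤ 0 := min_le_left _ _
  have h2 : 0 ≤ max 0 (max (t 0) (max (t 1) (t 2))) := le_max_left _ _
  linarith

/-- The Kuhn hat at the origin is `1`. -/
theorem hat_zero
    (hφ : ∀ t, φ t = max 0 (1 + min 0 (min (t 0) (min (t 1) (t 2))) - max 0 (max (t 0) (max (t 1) (t 2))))) :
    φ 0 = 1 := by
  rw [hφ]; simp

/-- Support, upper side: the hat vanishes once one coordinate is `≥ 1`. -/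
theorem hat_eq_zero_of_one_le
    (hφ : ∀ t, φ t = max 0 (1 + min 0 (min (t 0) (min (t 1) (t 2))) - max 0 (max (t 0) (max (t 1) (t 2)))))
    {t : Fin 3 → ℝ} {i : Fin 3} (h : 1 ≤ t i) : φ t = 0 := by
  rw [hφ]
  refine max_eq_left ?_
  have h1 : min 0 (min (t 0) (min (t 1) (t 2))) ≤ 0 := min_le_left _ _
  have h2 := le_max0_max3 t i
  linarith

/-- Support, lower side: the hat vanishes once one coordinate is `≤ -1`. -/
theorem hat_eq_zero_of_le_neg_one
    (hφ : ∀ t, φ t = max 0 (1 + min 0 (min (t 0) (min (t 1) (t 2))) - max 0 (max (t 0) (max (t 1) (t 2)))))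
    {t : Fin 3 → ℝ} {i : Fin 3} (h : t i ≤ -1) : φ t = 0 := by
  rw [hφ]
  refine max_eq_left ?_
  have h1 := min0_min3_le t i
  have h2 : 0 ≤ max 0 (max (t 0) (max (t 1) (t 2))) := le_max_left _ _
  linarith

/-- The Kuhn hat is continuous (a `max`∕`min` polynomial of the coordinates). -/
theorem continuous_hat
    (hφ : ∀ t, φ t = max 0 (1 + min 0 (min (t 0) (min (t 1) (t 2))) - max 0 (max (t 0) (max (t 1) (t 2))))) :
    Continuous φ := by
  have : φ = fun t => max 0 (1 + min 0 (min (t 0) (min (t 1) (t 2))) - max 0 (max (t 0) (max (t 1) (t 2)))) :=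
    funext hφ
  rw [this]
  fun_prop

/-- A lattice point other than the origin carries hat weight `0`; the origin carries `1` (nodal exactness of the `P1` basis). -/
theorem hat_intCast
    (hφ : ∀ t, φ t = max 0 (1 + min 0 (min (t 0) (min (t 1) (t 2))) - max 0 (max (t 0) (max (t 1) (t 2)))))
    (w : Zd 3) : φ (fun i => (w i : ℝ)) = if w = 0 then 1 else 0 := by
  split_ifs with hw
  · subst hw
    have : (fun i => ((0 : Zd 3) i : ℝ)) = 0 := by funext i; simp
    rw [this, hat_zero φ hφ]
  · obtain ⟨i, hi⟩ : ∃ i, w i ≠ 0 := by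
      by_contra h; push Not at h; exact hw (funext h)
    rcases lt_or_gt_of_ne hi with hlt | hgt
    · have : (w i : ℝ) ≤ -1 := by exact_mod_cast (show w i ≤ -1 by omega)
      exact hat_eq_zero_of_le_neg_one φ hφ (t := fun i => (w i : ℝ)) this
    · have : (1 : ℝ) ≤ (w i : ℝ) := by exact_mod_cast (show 1 ≤ w i by omega)
      exact hat_eq_zero_of_one_le φ hφ (t := fun i => (w i : ℝ)) this

/-! ## §2 The hat on the closed Kuhn simplex of `σ`

The closed Kuhn simplex of the permutation `σ` (relative coordinates `t = x - y` in the unit cube at `y`) is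
`1 ≥ t (σ 0) ≥ t (σ 1) ≥ t (σ 2) ≥ 0`; its vertices are the monotone lattice path `v_0 = 0`, `v_{k+1} = v_k + e_{σ k}`, i.e.
`v_k = fun i => if σ⁻¹ i < k then 1 else 0` (`k ≤ 3`). -/

/-- ★ On the closed Kuhn simplex of `σ`, the hat at the path vertex `v_k` (`k ≤ 3`) is the `k`-th BARYCENTRIC coordinate:
`1 - t (σ 0)`, `t (σ 0) - t (σ 1)`, `t (σ 1) - t (σ 2)`, `t (σ 2)` for `k = 0, 1, 2, 3`. -/
theorem hat_sub_vertex
    (hφ : ∀ t, φ t = max 0 (1 + min 0 (min (t 0) (min (t 1) (t 2))) - max 0 (max (t 0) (max (t 1) (t 2)))))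
    (σ : Equiv.Perm (Fin 3)) {t : Fin 3 → ℝ}
    (h0 : 0 ≤ t (σ 2)) (h1 : t (σ 2) ≤ t (σ 1)) (h2 : t (σ 1) ≤ t (σ 0)) (h3 : t (σ 0) ≤ 1) (k : ℕ) (hk : k ≤ 3) :
    φ (fun i => t i - if ((σ.symm i : Fin 3) : ℕ) < k then 1 else 0) =
      if k = 0 then 1 - t (σ 0) else if k = 1 then t (σ 0) - t (σ 1) else if k = 2 then t (σ 1) - t (σ 2)
      else t (σ 2) := by
  rw [hφ]
  rw [min3_perm (fun i => t i - if ((σ.symm i : Fin 3) : ℕ) < k then 1 else 0) σ,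
    max3_perm (fun i => t i - if ((σ.symm i : Fin 3) : ℕ) < k then 1 else 0) σ]
  simp only [Equiv.symm_apply_apply, Fin.val_zero, Fin.val_one, Fin.val_two]
  interval_cases k
  · -- k = 0 : weights (a, b, c)
    simp only [Nat.not_lt_zero, reduceIte, sub_zero]
    rw [show min (t (σ 1)) (t (σ 2)) = t (σ 2) from min_eq_right h1,
      show min (t (σ 0)) (t (σ 2)) = t (σ 2) from min_eq_right (h1.trans h2),
      show min (0:ℝ) (t (σ 2)) = 0 from min_eq_left h0,
      show max (t (σ 1)) (t (σ 2)) = t (σ 1) from max_eq_left h1,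
      show max (t (σ 0)) (t (σ 1)) = t (σ 0) from max_eq_left h2,
      show max (0:ℝ) (t (σ 0)) = t (σ 0) from max_eq_right (h0.trans (h1.trans h2))]
    rw [max_eq_right (by linarith)]; ring
  · -- k = 1 : weights (a-1, b, c)
    simp only [Nat.lt_one_iff, show (1:ℕ) = 0 ↔ False by decide, show (2:ℕ) = 0 ↔ False by decide,
      reduceIte, sub_zero]
    rw [show min (t (σ 1)) (t (σ 2)) = t (σ 2) from min_eq_right h1,
      show min (t (σ 0) - 1) (t (σ 2)) = t (σ 0) - 1 from min_eq_left (by linarith),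
      show min (0:ℝ) (t (σ 0) - 1) = t (σ 0) - 1 from min_eq_right (by linarith),
      show max (t (σ 1)) (t (σ 2)) = t (σ 1) from max_eq_left h1,
      show max (t (σ 0) - 1) (t (σ 1)) = t (σ 1) from max_eq_right (by linarith),
      show max (0:ℝ) (t (σ 1)) = t (σ 1) from max_eq_right (h0.trans h1)]
    rw [max_eq_right (by linarith)]; ring
  · -- k = 2 : weights (a-1, b-1, c)
    simp only [show (0:ℕ) < 2 ↔ True by decide, show (1:ℕ) < 2 ↔ True by decide, show (2:ℕ) < 2 ↔ False by decide,
      show (2:ℕ) = 0 ↔ False by decide, show (2:ℕ) = 1 ↔ False by decide, reduceIte, sub_zero]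
    rw [show min (t (σ 1) - 1) (t (σ 2)) = t (σ 1) - 1 from min_eq_left (by linarith),
      show min (t (σ 0) - 1) (t (σ 1) - 1) = t (σ 1) - 1 from min_eq_right (by linarith),
      show min (0:ℝ) (t (σ 1) - 1) = t (σ 1) - 1 from min_eq_right (by linarith),
      show max (t (σ 1) - 1) (t (σ 2)) = t (σ 2) from max_eq_right (by linarith),
      show max (t (σ 0) - 1) (t (σ 2)) = t (σ 2) from max_eq_right (by linarith),
      show max (0:ℝ) (t (σ 2)) = t (σ 2) from max_eq_right h0]
    rw [max_eq_right (by linarith)]; ring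
  · -- k = 3 : weights (a-1, b-1, c-1)
    simp only [show (0:ℕ) < 3 ↔ True by decide, show (1:ℕ) < 3 ↔ True by decide, show (2:ℕ) < 3 ↔ True by decide,
      show (3:ℕ) = 0 ↔ False by decide, show (3:ℕ) = 1 ↔ False by decide, show (3:ℕ) = 2 ↔ False by decide,
      reduceIte]
    rw [show min (t (σ 1) - 1) (t (σ 2) - 1) = t (σ 2) - 1 from min_eq_right (by linarith),
      show min (t (σ 0) - 1) (t (σ 2) - 1) = t (σ 2) - 1 from min_eq_right (by linarith),
      show min (0:ℝ) (t (σ 2) - 1) = t (σ 2) - 1 from min_eq_right (by linarith),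
      show max (t (σ 1) - 1) (t (σ 2) - 1) = t (σ 1) - 1 from max_eq_left (by linarith),
      show max (t (σ 0) - 1) (t (σ 1) - 1) = t (σ 0) - 1 from max_eq_left (by linarith),
      show max (0:ℝ) (t (σ 0) - 1) = 0 from max_eq_left (by linarith)]
    rw [max_eq_right (by linarith)]; ring

/-- The four barycentric coordinates are non-negative on the closed simplex (each is a hat value). -/
theorem bary_nonneg (σ : Equiv.Perm (Fin 3)) {t : Fin 3 → ℝ}
    (h0 : 0 ≤ t (σ 2)) (h1 : t (σ 2) ≤ t (σ 1)) (h2 : t (σ 1) ≤ t (σ 0)) (h3 : t (σ 0) ≤ 1) (k : ℕ) :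
    0 ≤ (if k = 0 then 1 - t (σ 0) else if k = 1 then t (σ 0) - t (σ 1) else if k = 2 then t (σ 1) - t (σ 2)
      else t (σ 2)) := by
  split_ifs <;> linarith

/-- The four barycentric coordinates sum to `1`. -/
theorem sum_bary_eq_one (σ : Equiv.Perm (Fin 3)) (t : Fin 3 → ℝ) :
    ∑ k ∈ Finset.range 4, (if k = 0 then 1 - t (σ 0) else if k = 1 then t (σ 0) - t (σ 1)
      else if k = 2 then t (σ 1) - t (σ 2) else t (σ 2)) = 1 := by
  simp [Finset.sum_range_succ]

/-- ★ On the closed Kuhn simplex of `σ`, the hat VANISHES at every lattice point that is not one of the four path vertices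
`v_k`, `k ≤ 3` — far points by the support letters, the four off-path cube corners because a `0` precedes a `1` along `σ`. -/
theorem hat_sub_int_eq_zero
    (hφ : ∀ t, φ t = max 0 (1 + min 0 (min (t 0) (min (t 1) (t 2))) - max 0 (max (t 0) (max (t 1) (t 2)))))
    (σ : Equiv.Perm (Fin 3)) {t : Fin 3 → ℝ}
    (h0 : 0 ≤ t (σ 2)) (h1 : t (σ 2) ≤ t (σ 1)) (h2 : t (σ 1) ≤ t (σ 0)) (h3 : t (σ 0) ≤ 1) (w : Zd 3)
    (hw : ∀ k ≤ 3, w ≠ fun i => if ((σ.symm i : Fin 3) : ℕ) < k then 1 else 0) :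
    φ (fun i => t i - (w i : ℝ)) = 0 := by
  -- sorted values of `t`
  have hsort : ∀ j j' : Fin 3, j ≤ j' → t (σ j') ≤ t (σ j) := by
    intro j j' hjj
    fin_cases j <;> fin_cases j'
    all_goals first | exact le_rfl | exact h2 | exact h1 | exact h1.trans h2 | exact absurd hjj (by decide)
  have htop : ∀ j : Fin 3, t (σ j) ≤ 1 := fun j => (hsort 0 j (Fin.zero_le _)).trans h3
  have hbot : ∀ j : Fin 3, 0 ≤ t (σ j) := fun j => h0.trans (hsort j 2 (Fin.le_last j |>.trans_eq rfl))
  -- (a) a coordinate `≥ 2`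
  by_cases hA : ∃ j, 2 ≤ w (σ j)
  · obtain ⟨j, hj⟩ := hA
    refine hat_eq_zero_of_le_neg_one φ hφ (i := σ j) ?_
    have : (2 : ℝ) ≤ w (σ j) := by exact_mod_cast hj
    show t (σ j) - (w (σ j) : ℝ) ≤ -1
    linarith [htop j]
  -- (b) a coordinate `≤ -1`
  by_cases hB : ∃ j, w (σ j) ≤ -1
  · obtain ⟨j, hj⟩ := hB
    refine hat_eq_zero_of_one_le φ hφ (i := σ j) ?_
    have : (w (σ j) : ℝ) ≤ -1 := by exact_mod_cast hj
    show (1 : ℝ) ≤ t (σ j) - (w (σ j) : ℝ)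
    linarith [hbot j]
  push Not at hA hB
  have h01 : ∀ j, w (σ j) = 0 ∨ w (σ j) = 1 := fun j => by
    have := hA j; have := hB j; omega
  -- (c) a `0` before a `1` along `σ`
  by_cases hC : ∃ j j' : Fin 3, j < j' ∧ w (σ j) = 0 ∧ w (σ j') = 1
  · obtain ⟨j, j', hjj, hj, hj'⟩ := hC
    rw [hφ]
    refine max_eq_left ?_
    have hm := min0_min3_le (fun i => t i - (w i : ℝ)) (σ j')
    have hM := le_max0_max3 (fun i => t i - (w i : ℝ)) (σ j)
    simp only [hj, hj', Int.cast_zero, Int.cast_one, sub_zero] at hm hM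
    linarith [hsort j j' hjj.le]
  -- (d) otherwise `w` IS a path vertex: contradiction
  exfalso
  push Not at hC
  have hmono : ∀ j j' : Fin 3, j < j' → w (σ j) = 0 → w (σ j') = 0 := fun j j' hjj hj => by
    rcases h01 j' with h | h
    · exact h
    · exact absurd h (hC j j' hjj hj)
  -- the number of leading ones
  have key : ∃ k ≤ 3, ∀ j : Fin 3, w (σ j) = if (j : ℕ) < k then 1 else 0 := by
    rcases h01 0 with a0 | a0
    · refine ⟨0, by norm_num, fun j => ?_⟩
      have : w (σ j) = 0 := by
        rcases eq_or_lt_of_le (Fin.zero_le j) with hj | hj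
        · rw [← hj]; exact a0
        · exact hmono 0 j hj a0
      simp [this]
    rcases h01 1 with a1 | a1
    · refine ⟨1, by norm_num, fun j => ?_⟩
      fin_cases j
      · simp [a0]
      · simp [a1]
      · simpa using hmono 1 2 (by decide) a1
    rcases h01 2 with a2 | a2
    · refine ⟨2, by norm_num, fun j => ?_⟩
      fin_cases j
      · simp [a0]
      · simp [a1]
      · simp [a2]
    · refine ⟨3, le_rfl, fun j => ?_⟩
      fin_cases j
      · simp [a0]
      · simp [a1]
      · simp [a2]
  obtain ⟨k, hk, hwk⟩ := key
  refine hw k hk (funext fun i => ?_)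
  simpa using hwk (σ.symm i)

/-- Every point is sorted (non-increasingly) by some permutation: `t (σ 2) ≤ t (σ 1) ≤ t (σ 0)` — so the six closed Kuhn simplices cover
the cube (`Tuple.sort`, read backwards). -/
theorem exists_perm_antitone (t : Fin 3 → ℝ) :
    ∃ σ : Equiv.Perm (Fin 3), t (σ 2) ≤ t (σ 1) ∧ t (σ 1) ≤ t (σ 0) := by
  have hm := Tuple.monotone_sort t
  refine ⟨(Tuple.sort t) * Fin.revPerm, ?_, ?_⟩
  · have := hm (show (0 : Fin 3) ≤ 1 by decide)
    simpa [Equiv.Perm.mul_apply, Fin.revPerm_apply] using this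
  · have := hm (show (1 : Fin 3) ≤ 2 by decide)
    simpa [Equiv.Perm.mul_apply, Fin.revPerm_apply] using this

end Summit.QuantumFields.YangMills.Theorems.PoincareLipschitzKuhnHat
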